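import Summits.HodgeConjecture.HodgeCM.PerL34.StepsVacuity_1

/-! PORT of `HodgeCM/PerL34/StepsVacuity.lean` (HodgeCMPerL run 82) — part 2: continuation of `Summits.HodgeConjecture.HodgeCM.PerL34.StepsVacuity_1` (split at a top-level declaration boundary by port_pkg.py; scope re-opened below; declarations unchanged). -/

-- port_pkg: scope re-opened for this part (file-level context, then the namespace/section stack open at the cut)
noncomputable section
namespace HodgeCM
namespace PerL34
namespace StepsVacuity
open HodgeCM.PerL34.WedgeNonvanishing HodgeCM.PerL34.WedgeToClasses
open scoped Matrix
variable {U : Universe}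
variable (T : U.ThetaModel)
variable {L : CMField} {ι₁ : L →+* ℂ}
/-- (Ported verbatim from the HodgeCMPerL package; no docstring in the source.) -/
theorem formsInput_iff' : FormsInput T ↔ Open_thetaWedgeHereditary T :=
  ⟨hereditary_of_formsInput T HodgeCM.levelDirected, fun h =>
    stepsInput_imp_formsInput (T := T)
      (stepsInput_of_stepsPrintInput (T := T) n33eClosed_holds (stepsPrintInput_of_hereditary T h))⟩

/-- pv03's ball record (run 20) ⇒ hereditary A6. -/
theorem hereditary_of_ballSteps (h : BallGlue.BallStepsInput T) : Open_thetaWedgeHereditary T :=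
  (stepsPrintInput_iff' T).1 (BallGlue.stepsPrintInput_of_ball T h)

/-- pv03's span record (run 21) ⇒ hereditary A6. -/
theorem hereditary_of_ballSpans (h : BallSpans.BallSpanStepsInput T) : Open_thetaWedgeHereditary T :=
  hereditary_of_ballSteps T (BallSpans.ballStepsInput_of_spans T h)

/-- pv02-g2's character record (run 21) + `Open_chars` (node N31) ⇒ hereditary A6.  Compose with
`CharSpansWeil.charSpanStepsInput_of_weil` (run 22), `CharSpansCR.charSpanStepsInput_of_CR`,
`CharSpansFinal.charSpanStepsInput_of_CRΔ` (run 23) for the Weil-package records. -/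
theorem hereditary_of_charSpans (hch : T.Open_chars) (h : CharSpans.CharSpanStepsInput T) :
    Open_thetaWedgeHereditary T :=
  hereditary_of_ballSpans T (CharSpans.ballSpanStepsInput_of_chars T hch h)

end StepsVacuity
end PerL34
end HodgeCM

end

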